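import Literature.MathematicalPhysics.QuantumLattice.HubbardUniformDensityGibbs
import Literature.MathematicalPhysics.QuantumLattice.MagneticHubbardTorus
import HarnessLib

/-!
# Uniform density at half filling in an arbitrary magnetic field (Lieb–Loss–McCann, complex case)

Lieb, Loss and McCann, *Uniform density theorem for the Hubbard model*, J. Math. Phys. **34** (1993)
891, Theorem eqs. (5)–(6) and its proof in "the complex case" (p. 893): for a Hermitian bipartite
hopping matrix with COMPLEX entries ("in the absence of magnetic fields … `T` is real"; with a
field it is not) the Hamiltonian is invariant under the antiunitary `Y = JW` (`J` = complex
conjugation, `W` = MacLachlan's hole–particle map), and the uniform density theorem holds verbatim: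
`ρ_{βσ}(x,x) = ½`, `ρ_{βσ}(x,y) = 0` for `x ≠ y` on the same sublattice, at every temperature.

This file instantiates the abstract complex-case theorems of `HubbardUniformDensityGibbs.lean` (§7,
`gibbsState_creation_mul_annihilation_eq_half_ite_of_transpose`, hypothesis `P Kᵀ Pᴴ = K`) for the
tree's **Hubbard torus in a lattice `U(1)` gauge field** `magneticHubbardTorus L A t U` (Peierls
phases `A : GaugeConfig 2 L Circle`, `MagneticHubbardTorus.lean`; Lieb, PRL 73 (1994) 2158 eq. (1)) on
the even torus `(ℤ/Lℤ)²`, at the particle–hole symmetric chemical potential `μ = U/2`: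

* `particleHole_mul_transpose_magneticHubbardTorus_sub_mul_conjTranspose` — `Y`-invariance:
  `P (H_A − (U/2)N)ᵀ Pᴴ = H_A − (U/2)N` for EVERY gauge field `A` (`L` even; `P` the particle–hole
  unitary of Yang's sign `ε_x = (−1)^{x₁+x₂}`): the Peierls term `A c†_{x+eᵢ} c_x` transposes to
  `A c†_x c_{x+eᵢ}` (the Jordan–Wigner matrices are real) and `P c†_x c_{x+eᵢ} Pᴴ = c†_{x+eᵢ} c_x`
  (`ε_x ε_{x+eᵢ} = −1`, CAR); the on-site part is the real, particle–hole invariant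
  `hamiltonianWith _ 0 U (U/2)`;
* `magneticHubbardTorus_gibbsState_creation_mul_annihilation_halfFilling` — for every `A`, `t`, `U`,
  `β`: `⟨c†_{xσ} c_{yτ}⟩_β = ½ δ_{(x,σ),(y,τ)}` in the Gibbs state of `H_A − (U/2)N` whenever
  `ε_x = ε_y`; hence `⟨n_{xσ}⟩_β = ½` and `⟨N⟩_β = L²` (`…_numberOp_halfFilling`,
  `…_totalNumber_halfFilling`) — the density of the half-filled band is uniform in ANY magnetic field
  ("the persistence of uniformity in the face of randomness is striking", LLM p. 891);
* `magneticHubbardTorus_gibbsState_numberProj_mul_creation_mul_annihilation` — the canonical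
  (`N = L²`) form; `magneticHubbardTorus_groundStateFunctional_creation_mul_annihilation_halfFilling` —
  the `β → ∞` tracial ground state of `H_A − (U/2)N`.

Everything is PROVED; no definition, no named fact. Honest scope: Peierls phases on the
nearest-neighbour square torus only (the tree's `magneticHubbardTorus`); general complex bipartite `T`
is covered abstractly by §7 of the companion file.

References: Lieb–Loss–McCann 1993 [LiebLossMccann1993]; E. H. Lieb, *Flux phase of the half-filled
band*, PRL 73 (1994) 2158 [Lieb1994] (the Hamiltonian (1); half filling); E. H. Lieb, PRL 62 (1989)
1201 [LiebPRL1989] (hole–particle transformation).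
-/

noncomputable section

namespace Literature.MathematicalPhysics.QuantumLattice

open Matrix Finset HubbardWave0 NormedSpace Literature.MathematicalPhysics.QuantumFieldTheory
open scoped ComplexOrder

section MagneticTorus

variable {L : ℕ} [NeZero L]

/-- (Local to this file, as in `HubbardCorrelatorCertificate` / `HubbardSectorCorrelatorCertificate`:
pins `DecidableEq (FermionTorus 2 L)` to the `LinearOrder` one, so that the `Finset (Orb _)`-indexed
matrix types of this file and of the general-`Λ` theorems it instantiates agree syntactically.) [folklore] -/
local instance (priority := high) instDecidableEqFermionTorusMagneticUniformDensity :
    DecidableEq (FermionTorus 2 L) :=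
  LinearOrder.toDecidableEq

/-- Transpose of a hopping monomial: `(c†_p c_q)ᵀ = c†_q c_p` (the Jordan–Wigner matrices are real,
`cᵀ = c†`). [cite: LiebLossMccann1993, proof of Theorem (real `T`: "`ρ_{βσ}` is evidently real")] -/
theorem transpose_creation_mul_annihilation {ι : Type*} [LinearOrder ι] [Fintype ι] (p q : ι) :
    (creation p * annihilation q)ᵀ = creation q * annihilation p := by
  rw [transpose_mul, annihilation_transpose, creation_transpose]

/-- One lattice step flips Yang's sign: `ε(x + eᵢ) = −ε(x)` on the torus of even side, in the
`TorusSite` coordinates of `magneticHubbardTorus`. [cite: LiebPRL1989, Theorem 2 (bipartite lattice)] -/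
theorem torusStagger_ofTorusSite_shift (hL : Even L) (x : Site 2 L) (i : Fin 2) :
    torusStagger (FermionTorus.ofTorusSite (Site.shift x i)) =
      -torusStagger (FermionTorus.ofTorusSite (L := L) x) :=
  torusStagger_eq_neg_of_toTorusSite_eq hL (by
    rw [FermionTorus.toTorusSite_ofTorusSite, FermionTorus.toTorusSite_ofTorusSite]; rfl)

/-- **The particle–hole conjugate of a Peierls bond**: `P (c†_{xσ} c_{x+eᵢ,σ}) Pᴴ = c†_{x+eᵢ,σ} c_{xσ}`
and `P (c†_{x+eᵢ,σ} c_{xσ}) Pᴴ = c†_{xσ} c_{x+eᵢ,σ}` (`ε_x ε_{x+eᵢ} = −1`, CAR), `P` the particle–hole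
unitary of `ε`. [cite: LiebLossMccann1993, proof of Theorem (eq. (7))] [cite: LiebPRL1989, Theorem 2 (proof)] -/
theorem particleHole_mul_bond_mul_conjTranspose (hL : Even L) (x : Site 2 L) (i σ : Fin 2) :
    particleHole (fun j : Orb (FermionTorus 2 L) => ((torusStagger (ofLex j).1 : ℤ) : ℂ)) *
        (creation (orb (FermionTorus.ofTorusSite x) σ) *
          annihilation (orb (FermionTorus.ofTorusSite (Site.shift x i)) σ)) *
        (particleHole (fun j : Orb (FermionTorus 2 L) => ((torusStagger (ofLex j).1 : ℤ) : ℂ)))ᴴ =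
      creation (orb (FermionTorus.ofTorusSite (Site.shift x i)) σ) *
        annihilation (orb (FermionTorus.ofTorusSite x) σ) ∧
    particleHole (fun j : Orb (FermionTorus 2 L) => ((torusStagger (ofLex j).1 : ℤ) : ℂ)) *
        (creation (orb (FermionTorus.ofTorusSite (Site.shift x i)) σ) *
          annihilation (orb (FermionTorus.ofTorusSite x) σ)) *
        (particleHole (fun j : Orb (FermionTorus 2 L) => ((torusStagger (ofLex j).1 : ℤ) : ℂ)))ᴴ =
      creation (orb (FermionTorus.ofTorusSite x) σ) *
        annihilation (orb (FermionTorus.ofTorusSite (Site.shift x i)) σ) := by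
  have hε := torusStagger_ofTorusSite_shift hL x i
  have hne : FermionTorus.ofTorusSite (L := L) x ≠ FermionTorus.ofTorusSite (Site.shift x i) := by
    intro h
    rw [← h] at hε
    exact units_ne_neg_self _ hε
  have hne1 : orb (FermionTorus.ofTorusSite (L := L) x) σ ≠
      orb (FermionTorus.ofTorusSite (Site.shift x i)) σ := fun h => hne (orb_inj.1 h).1
  have hne2 : orb (FermionTorus.ofTorusSite (Site.shift x i)) σ ≠
      orb (FermionTorus.ofTorusSite (L := L) x) σ := fun h => hne (orb_inj.1 h).1.symm
  have hprod1 : ((torusStagger (FermionTorus.ofTorusSite (L := L) x) : ℤ) : ℂ) *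
      ((torusStagger (FermionTorus.ofTorusSite (Site.shift x i)) : ℤ) : ℂ) = -1 := by
    rw [mul_comm]
    exact intCast_units_mul_of_eq_neg hε
  have hprod2 : ((torusStagger (FermionTorus.ofTorusSite (Site.shift x i)) : ℤ) : ℂ) *
      ((torusStagger (FermionTorus.ofTorusSite (L := L) x) : ℤ) : ℂ) = -1 :=
    intCast_units_mul_of_eq_neg hε
  constructor
  · rw [particleHole_mul_creation_mul_annihilation_mul_conjTranspose
      (fun j : Orb (FermionTorus 2 L) => torusStagger (ofLex j).1) (orb (FermionTorus.ofTorusSite x) σ)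
      (orb (FermionTorus.ofTorusSite (Site.shift x i)) σ), if_neg hne1,
      show ((torusStagger (ofLex (orb (FermionTorus.ofTorusSite (L := L) x) σ)).1 : ℤ) : ℂ) *
          ((torusStagger (ofLex (orb (FermionTorus.ofTorusSite (Site.shift x i)) σ)).1 : ℤ) : ℂ) = -1
        from hprod1, zero_sub, neg_one_smul, neg_neg]
  · rw [particleHole_mul_creation_mul_annihilation_mul_conjTranspose
      (fun j : Orb (FermionTorus 2 L) => torusStagger (ofLex j).1)
      (orb (FermionTorus.ofTorusSite (Site.shift x i)) σ) (orb (FermionTorus.ofTorusSite x) σ), if_neg hne2,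
      show ((torusStagger (ofLex (orb (FermionTorus.ofTorusSite (Site.shift x i)) σ)).1 : ℤ) : ℂ) *
          ((torusStagger (ofLex (orb (FermionTorus.ofTorusSite (L := L) x) σ)).1 : ℤ) : ℂ) = -1
        from hprod2, zero_sub, neg_one_smul, neg_neg]

/-- `H_A − (U/2)N = −t · (Peierls hopping) + (H(0,U) − (U/2)N)`: the on-site part of the magnetic
torus is the field-free grand-canonical Hubbard Hamiltonian at `t = 0`, `μ = U/2`. [folklore]
[cite: Lieb1994, eq. (1)] -/
theorem magneticHubbardTorus_sub_half_totalNumber_eq (A : GaugeConfig 2 L Circle) (t U : ℝ) :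
    magneticHubbardTorus L A t U - (((U / 2 : ℝ)) : ℂ) • totalNumber =
      -(t : ℂ) • (∑ x : Site 2 L, ∑ i : Fin 2, ∑ σ : Fin 2,
        (((A (x, i) : Circle) : ℂ) •
            (creation (orb (FermionTorus.ofTorusSite (Site.shift x i)) σ) *
              annihilation (orb (FermionTorus.ofTorusSite x) σ)) +
          (starRingEnd ℂ) ((A (x, i) : Circle) : ℂ) •
            (creation (orb (FermionTorus.ofTorusSite x) σ) *
              annihilation (orb (FermionTorus.ofTorusSite (Site.shift x i)) σ)))) +
      hamiltonianWith (fermionTorusGraph 2 L) 0 U (U / 2) := by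
  rw [magneticHubbardTorus_eq, hamiltonianWith_eq, hamiltonian]
  simp only [Complex.ofReal_zero, neg_zero, zero_smul, zero_add]
  rw [add_sub_assoc]

/-- **`Y = JW`-invariance of the magnetic Hubbard torus at `μ = U/2`** (LLM, complex case): for EVERY
gauge field `A`, `L` even, `P (H_A − (U/2)N)ᵀ Pᴴ = H_A − (U/2)N`, `P` the particle–hole unitary of
Yang's sign. [cite: LiebLossMccann1993, proof of Theorem (complex case: "it is invariant under the antiunitary transformation `Y = JW`")] -/
theorem particleHole_mul_transpose_magneticHubbardTorus_sub_mul_conjTranspose (hL : Even L)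
    (A : GaugeConfig 2 L Circle) (t U : ℝ) :
    particleHole (fun j : Orb (FermionTorus 2 L) => ((torusStagger (ofLex j).1 : ℤ) : ℂ)) *
        (magneticHubbardTorus L A t U - (((U / 2 : ℝ)) : ℂ) • totalNumber)ᵀ *
        (particleHole (fun j : Orb (FermionTorus 2 L) => ((torusStagger (ofLex j).1 : ℤ) : ℂ)))ᴴ =
      magneticHubbardTorus L A t U - (((U / 2 : ℝ)) : ℂ) • totalNumber := by
  -- the on-site part: real and particle–hole invariant
  have hK0T : (hamiltonianWith (fermionTorusGraph 2 L) 0 U (U / 2))ᵀ =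
      hamiltonianWith (fermionTorusGraph 2 L) 0 U (U / 2) := by
    rw [← conjTranspose_hamiltonianWith_eq_transpose,
      (isHermitian_hamiltonianWith (fermionTorusGraph 2 L) 0 U (U / 2)).eq]
  have hK0 : particleHole (fun j : Orb (FermionTorus 2 L) => ((torusStagger (ofLex j).1 : ℤ) : ℂ)) *
      hamiltonianWith (fermionTorusGraph 2 L) 0 U (U / 2) *
      (particleHole (fun j : Orb (FermionTorus 2 L) => ((torusStagger (ofLex j).1 : ℤ) : ℂ)))ᴴ =
      hamiltonianWith (fermionTorusGraph 2 L) 0 U (U / 2) :=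
    particleHole_mul_hamiltonianWith_half_mul_conjTranspose (fermionTorusGraph 2 L) torusStagger
      (fun _ _ h => torusStagger_eq_neg_of_adj_holds hL h) 0 U
  -- the Peierls part, bond by bond
  have hbond : ∀ (x : Site 2 L) (i σ : Fin 2),
      particleHole (fun j : Orb (FermionTorus 2 L) => ((torusStagger (ofLex j).1 : ℤ) : ℂ)) *
        ((((A (x, i) : Circle) : ℂ) •
            (creation (orb (FermionTorus.ofTorusSite (Site.shift x i)) σ) *
              annihilation (orb (FermionTorus.ofTorusSite x) σ)) +
          (starRingEnd ℂ) ((A (x, i) : Circle) : ℂ) •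
            (creation (orb (FermionTorus.ofTorusSite x) σ) *
              annihilation (orb (FermionTorus.ofTorusSite (Site.shift x i)) σ)))ᵀ) *
        (particleHole (fun j : Orb (FermionTorus 2 L) => ((torusStagger (ofLex j).1 : ℤ) : ℂ)))ᴴ =
        ((A (x, i) : Circle) : ℂ) •
            (creation (orb (FermionTorus.ofTorusSite (Site.shift x i)) σ) *
              annihilation (orb (FermionTorus.ofTorusSite x) σ)) +
          (starRingEnd ℂ) ((A (x, i) : Circle) : ℂ) •
            (creation (orb (FermionTorus.ofTorusSite x) σ) *
              annihilation (orb (FermionTorus.ofTorusSite (Site.shift x i)) σ)) := by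
    intro x i σ
    obtain ⟨h1, h2⟩ := particleHole_mul_bond_mul_conjTranspose hL x i σ
    rw [transpose_add, transpose_smul, transpose_smul, transpose_creation_mul_annihilation,
      transpose_creation_mul_annihilation, Matrix.mul_add, Matrix.add_mul, Matrix.mul_smul,
      Matrix.smul_mul, Matrix.mul_smul, Matrix.smul_mul, h1, h2]
  rw [magneticHubbardTorus_sub_half_totalNumber_eq, transpose_add, hK0T, Matrix.mul_add,
    Matrix.add_mul, hK0, transpose_smul, Matrix.mul_smul, Matrix.smul_mul]
  congr 1
  congr 1
  simp only [transpose_sum, Finset.mul_sum, Finset.sum_mul]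
  exact Finset.sum_congr rfl fun x _ => Finset.sum_congr rfl fun i _ =>
    Finset.sum_congr rfl fun σ _ => hbond x i σ

/-- `H_A − (U/2)N` is Hermitian. [cite: Lieb1994, eq. (1)] -/
theorem isHermitian_magneticHubbardTorus_sub_half_totalNumber (A : GaugeConfig 2 L Circle)
    (t U : ℝ) : (magneticHubbardTorus L A t U - (((U / 2 : ℝ)) : ℂ) • totalNumber).IsHermitian := by
  refine (magneticHubbardTorus_isHermitian A t U).sub ?_
  rw [IsHermitian, conjTranspose_smul, Complex.star_def, Complex.conj_ofReal,
    (posSemidef_totalNumber (Λ := FermionTorus 2 L)).1.eq]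

/-- **Uniform density of the half-filled band in an arbitrary magnetic field (Lieb–Loss–McCann,
complex case), grand canonical.** For every gauge field `A` on the even torus `(ℤ/Lℤ)²`, all real `t`,
`U` and every `β`, the Gibbs state of `H_A − (U/2)N` has `⟨c†_{xσ} c_{yτ}⟩_β = ½ δ_{(x,σ),(y,τ)}`
whenever `x, y` have the same parity. [cite: LiebLossMccann1993, Theorem eqs. (5)-(6) (complex case)] -/
theorem magneticHubbardTorus_gibbsState_creation_mul_annihilation_halfFilling (hL : Even L)
    (A : GaugeConfig 2 L Circle) (t U β : ℝ) {x y : FermionTorus 2 L}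
    (hxy : torusStagger x = torusStagger y) (σ τ : Fin 2) :
    gibbsState β (magneticHubbardTorus L A t U - (((U / 2 : ℝ)) : ℂ) • totalNumber)
        (creation (orb x σ) * annihilation (orb y τ)) =
      if orb x σ = orb y τ then (1 / 2 : ℂ) else 0 :=
  gibbsState_creation_mul_annihilation_eq_half_ite_of_transpose β
    (isHermitian_magneticHubbardTorus_sub_half_totalNumber A t U)
    (fun j : Orb (FermionTorus 2 L) => torusStagger (ofLex j).1)
    (particleHole_mul_transpose_magneticHubbardTorus_sub_mul_conjTranspose hL A t U)
    (a := orb x σ) (b := orb y τ) (by simpa [orb] using hxy)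

/-- **Eq. (5) in a magnetic field**: `⟨n_{xσ}⟩_β = ½` for every gauge field, site, spin, `t`, `U`, `β`.
[cite: LiebLossMccann1993, Theorem eq. (5) (complex case)] -/
theorem magneticHubbardTorus_gibbsState_numberOp_halfFilling (hL : Even L)
    (A : GaugeConfig 2 L Circle) (t U β : ℝ) (x : FermionTorus 2 L) (σ : Fin 2) :
    gibbsState β (magneticHubbardTorus L A t U - (((U / 2 : ℝ)) : ℂ) • totalNumber) (numberOp x σ) =
      1 / 2 := by
  rw [numberOp, magneticHubbardTorus_gibbsState_creation_mul_annihilation_halfFilling hL A t U β rfl,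
    if_pos rfl]

/-- **Exact half filling in a magnetic field**: `⟨N⟩_β = L²` in the Gibbs state of `H_A − (U/2)N`, for
every gauge field `A` and every `β`. [cite: LiebLossMccann1993, Theorem eq. (5) (complex case; `Tr ρ_{βσ} = |Λ|/2`)] -/
theorem magneticHubbardTorus_gibbsState_totalNumber_halfFilling (hL : Even L)
    (A : GaugeConfig 2 L Circle) (t U β : ℝ) :
    gibbsState β (magneticHubbardTorus L A t U - (((U / 2 : ℝ)) : ℂ) • totalNumber) totalNumber =
      (L : ℂ) ^ 2 := by
  set K := magneticHubbardTorus L A t U - (((U / 2 : ℝ)) : ℂ) • totalNumber with hK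
  have h2 : (totalNumber : Matrix (Finset (Orb (FermionTorus 2 L))) (Finset (Orb (FermionTorus 2 L))) ℂ) =
      ∑ x : FermionTorus 2 L, (numberOp x 0 + numberOp x 1) := by
    unfold totalNumber
    simp [Fin.sum_univ_two]
  have hn : ∀ (x : FermionTorus 2 L) (σ : Fin 2), gibbsState β K (numberOp x σ) = 1 / 2 := fun x σ => by
    rw [hK]
    exact magneticHubbardTorus_gibbsState_numberOp_halfFilling hL A t U β x σ
  rw [h2, map_sum]
  simp only [map_add, hn, Finset.sum_const, Finset.card_univ, card_fermionTorus, nsmul_eq_mul]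
  push_cast
  ring

/-- **The canonical form in a magnetic field** (`N = L²`, `μ = U/2`): with `Π = diag(1_{|s| = L²})`,
`⟨Π c†_{xσ} c_{yτ}⟩_β = ½ δ ⟨Π⟩_β` for `x, y` of the same parity, every gauge field.
[cite: LiebLossMccann1993, Theorem eqs. (5)-(6) (canonical, complex case)] -/
theorem magneticHubbardTorus_gibbsState_numberProj_mul_creation_mul_annihilation (hL : Even L)
    (A : GaugeConfig 2 L Circle) (t U β : ℝ) {x y : FermionTorus 2 L}
    (hxy : torusStagger x = torusStagger y) (σ τ : Fin 2) :
    gibbsState β (magneticHubbardTorus L A t U - (((U / 2 : ℝ)) : ℂ) • totalNumber)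
        (diagonal (fun s : Finset (Orb (FermionTorus 2 L)) =>
            if s.card = Fintype.card (FermionTorus 2 L) then (1 : ℂ) else 0) *
          (creation (orb x σ) * annihilation (orb y τ))) =
      (if orb x σ = orb y τ then (1 / 2 : ℂ) else 0) *
        gibbsState β (magneticHubbardTorus L A t U - (((U / 2 : ℝ)) : ℂ) • totalNumber)
          (diagonal (fun s : Finset (Orb (FermionTorus 2 L)) =>
            if s.card = Fintype.card (FermionTorus 2 L) then (1 : ℂ) else 0)) := by
  have hKN : ∀ s s' : Finset (Orb (FermionTorus 2 L)),
      (magneticHubbardTorus L A t U - (((U / 2 : ℝ)) : ℂ) • totalNumber :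
        Matrix (Finset (Orb (FermionTorus 2 L))) (Finset (Orb (FermionTorus 2 L))) ℂ) s s' ≠ 0 →
        s.card = s'.card := by
    intro s s' h
    by_cases hss : s = s'
    · rw [hss]
    · have hN0 : (totalNumber : Matrix (Finset (Orb (FermionTorus 2 L))) (Finset (Orb (FermionTorus 2 L))) ℂ)
          s s' = 0 := by
        rw [totalNumber_eq_diagonal_card, diagonal_apply_ne _ hss]
      have hH : magneticHubbardTorus L A t U s s' ≠ 0 := by
        intro h0
        apply h
        rw [Matrix.sub_apply, Matrix.smul_apply, h0, hN0, smul_zero, sub_zero]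
      have hp := preservesSectors_magneticHubbardTorus A t U s s' hH
      rw [card_eq_upPart_add_downPart s, card_eq_upPart_add_downPart s', hp.1, hp.2]
  exact gibbsState_numberProj_mul_creation_mul_annihilation_eq_of_transpose β
    (isHermitian_magneticHubbardTorus_sub_half_totalNumber A t U) hKN
    (fun j : Orb (FermionTorus 2 L) => torusStagger (ofLex j).1)
    (particleHole_mul_transpose_magneticHubbardTorus_sub_mul_conjTranspose hL A t U)
    (N := Fintype.card (FermionTorus 2 L)) (by rw [card_orb]) (a := orb x σ) (b := orb y τ)
    (by simpa [orb] using hxy)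

open _root_.Filter _root_.Topology in
/-- **Zero-temperature form in a magnetic field**: the tracial ground state of `H_A − (U/2)N` (uniform
mixture of all its ground states over the whole Fock space, `Matrix.groundStateFunctional` = the
`β → ∞` limit of the grand-canonical Gibbs state, `Matrix.tendsto_gibbsState_atTop_holds`) has
`ω₀(c†_{xσ} c_{yτ}) = ½ δ` for `x, y` of the same parity, every gauge field. (LLM's Remark III takes
`β → ∞` of the canonical state instead and notes the two limits may differ for `U ≠ 0`; (5)–(6) hold for
both, being `β`-independent — here the grand-canonical limit.)
[cite: LiebLossMccann1993, Remark III with Theorem eqs. (5)-(6) (complex case)] -/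
theorem magneticHubbardTorus_groundStateFunctional_creation_mul_annihilation_halfFilling (hL : Even L)
    (A : GaugeConfig 2 L Circle) (t U : ℝ) {x y : FermionTorus 2 L}
    (hxy : torusStagger x = torusStagger y) (σ τ : Fin 2) :
    (magneticHubbardTorus L A t U - (((U / 2 : ℝ)) : ℂ) • totalNumber).groundStateFunctional
        (creation (orb x σ) * annihilation (orb y τ)) =
      if orb x σ = orb y τ then (1 / 2 : ℂ) else 0 := by
  have hlim := Matrix.tendsto_gibbsState_atTop_holds
    (isHermitian_magneticHubbardTorus_sub_half_totalNumber A t U) (creation (orb x σ) * annihilation (orb y τ))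
  have hconst : Tendsto (fun β : ℝ => gibbsState β
      (magneticHubbardTorus L A t U - (((U / 2 : ℝ)) : ℂ) • totalNumber)
      (creation (orb x σ) * annihilation (orb y τ))) atTop
      (𝓝 (if orb x σ = orb y τ then (1 / 2 : ℂ) else 0)) := by
    have hfun : (fun β : ℝ => gibbsState β
        (magneticHubbardTorus L A t U - (((U / 2 : ℝ)) : ℂ) • totalNumber)
        (creation (orb x σ) * annihilation (orb y τ))) =
        fun _ => if orb x σ = orb y τ then (1 / 2 : ℂ) else 0 :=
      funext fun β =>
        magneticHubbardTorus_gibbsState_creation_mul_annihilation_halfFilling hL A t U β hxy σ τ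
    rw [hfun]
    exact tendsto_const_nhds
  exact tendsto_nhds_unique hlim hconst

end MagneticTorus

end Literature.MathematicalPhysics.QuantumLattice
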